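import Summits.QuantumAdvantage.QuantumAdvantage.Theorems.PerceptronDialLawsEA
import Literature.Computability.QuantumComplexity.ForrelationDerivativeTables

/-! # PerceptronDialLawsE — part 2/2 (mechanical split for landing of `PerceptronDialLawsE`; content verbatim; scopes re-opened with their variables) -/

set_option linter.dupNamespace false
noncomputable section

namespace Summit.QuantumAdvantage.QuantumAdvantage.Theorems.PerceptronDial
open Finset
open Literature.Computability.Complexity
open Literature.Computability.QuantumComplexity
open Literature.Computability.QuantumComplexity.BuzetChailloux (bxor zeroVec)
open Summit.QuantumAdvantage.QuantumAdvantage.Theses.AnfPresentation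
open Summit.QuantumAdvantage.QuantumAdvantage.Theorems.HintDial
open Summit.QuantumAdvantage.QuantumAdvantage.Theorems.HintDial.Automaton
open Summit.QuantumAdvantage.QuantumAdvantage.Theorems.HintDial (bit_xor bit_and bit_not bit_eq_ite bit_decide_odd bit_injective bit_mul_self bit_false eval_bit)
open CubicForm (bit)
open DerivativeWalsh (W)
open Summit.QuantumAdvantage.QuantumAdvantage.Theorems.PebbleDial (AnfIdx bitsFG bits)
variable {n k : ℕ}

section ThmA
variable {n : ℕ}
variable {m : ℕ}

/-- the inverse of `bit : Bool → ZMod 2` -/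
def unbit (z : ZMod 2) : Bool := decide (z ≠ 0)

/-- PerceptronDialLawsE helper `bit_unbit` (decomp-qadv land package; see the module docstring). -/
theorem bit_unbit (z : ZMod 2) : bit (unbit z) = z := by
  fin_cases z <;> decide

/-- PerceptronDialLawsE helper `unbit_bit` (decomp-qadv land package; see the module docstring). -/
theorem unbit_bit (b : Bool) : unbit (bit b) = b := by
  cases b <;> decide

/-- ★ the explicit phase `G_{P,B,c}(s,t) = ⟨t,s⟩ ⊕ Q_B(s) ⊕ P(ptv_B^c(s,t))` -/
def gph (P : QuadP (CVar m)) (B : Fin m → Fin m → Bool) (c : Bool) (x : Fin (m + m) → Bool) : Bool :=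
  xor (c0 B x) (unbit (P.ev (ptv B c x)))

/-- the two visible points over `(s,t,B)` are the two frozen points: `cval (s,t,B,b) = ptv_B^{b ⊕ c₀}(s,t)` -/
theorem cval_eq_ptv (x : Fin (m + m) → Bool) (B : Fin m → Fin m → Bool) (b : Bool) :
    cval (k := m) (sOf x, tOf x, B, b) = ptv B (xor b (c0 B x)) x := by
  funext i
  rcases i with a | a | aa | a | u <;> rfl

/-- PerceptronDialLawsE helper `sOf_bxor` (decomp-qadv land package; see the module docstring). -/
theorem sOf_bxor (x y : Fin (m + m) → Bool) : sOf (bxor x y) = bxor (sOf x) (sOf y) := rfl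
/-- PerceptronDialLawsE helper `sOf_zeroVec` (decomp-qadv land package; see the module docstring). -/
theorem sOf_zeroVec : sOf (zeroVec : Fin (m + m) → Bool) = zeroVec := rfl

/-- PerceptronDialLawsE helper `polar_bxor` (decomp-qadv land package; see the module docstring). -/
theorem polar_bxor (B : Fin m → Fin m → Bool) (s s' : Fin m → Bool) :
    polar B (bxor s s') = bxor (polar B s) (polar B s') := by
  unfold polar
  rw [mv_bxor, mv_bxor]
  funext a
  show xor (xor (mv (ut B) s a) (mv (ut B) s' a)) (xor (mv (tr (ut B)) s a) (mv (tr (ut B)) s' a))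
     = xor (xor (mv (ut B) s a) (mv (tr (ut B)) s a)) (xor (mv (ut B) s' a) (mv (tr (ut B)) s' a))
  cases mv (ut B) s a <;> cases mv (ut B) s' a <;> cases mv (tr (ut B)) s a <;> cases mv (tr (ut B)) s' a <;> rfl

/-- PerceptronDialLawsE helper `polar_zeroVec` (decomp-qadv land package; see the module docstring). -/
theorem polar_zeroVec (B : Fin m → Fin m → Bool) : polar B (zeroVec : Fin m → Bool) = zeroVec := by
  funext a
  show xor (bd (ut B a) zeroVec) (bd (tr (ut B) a) zeroVec) = false
  rw [bd_zeroVec_right, bd_zeroVec_right]; rfl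

/-- every coordinate of the frozen point is affine in `(s,t)` -/
theorem isAffZ_ptv (B : Fin m → Fin m → Bool) (c : Bool) (i : CVar m) :
    IsAffZ (fun x : Fin (m + m) → Bool => bit (ptv B c x i)) := by
  rcases i with a | a | aa | a | u
  · exact isAffZ_coord (Fin.castAdd m a)
  · exact isAffZ_coord (Fin.natAdd m a)
  · show IsAffZ (fun _ => bit (ut B aa.1 aa.2))
    exact isAffZ_const _
  · intro x y
    show bit (polar B (sOf (bxor x y)) a) = bit (polar B (sOf x) a) + bit (polar B (sOf y) a) + bit (polar B (sOf zeroVec) a)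
    rw [sOf_bxor, polar_bxor, sOf_zeroVec, polar_zeroVec]
    show bit (xor (polar B (sOf x) a) (polar B (sOf y) a)) = _
    rw [bit_xor]
    show _ = _ + bit false
    rw [bit_false, add_zero]
  · show IsAffZ (fun _ => bit c)
    exact isAffZ_const _

/-- ★ the phases of THEOREM A have algebraic degree `≤ 2` in `(s,t)` -/
theorem isDegTwo_gph (P : QuadP (CVar m)) (B : Fin m → Fin m → Bool) (c : Bool) : IsDegTwo (gph P B c) := by
  classical
  apply isDegTwo_of_Z
  have e : ∀ x, bit (gph P B c x)
      = (∑ a, bit (tOf x a) * bit (sOf x a) + ∑ a, ∑ a', bit (ut B a a') * (bit (sOf x a) * bit (sOf x a')))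
        + P.ev (ptv B c x) := fun x => by
    rw [gph, bit_xor, c0, bit_xor, bit_bd, bit_qf, bit_unbit]
  refine isDegTwoZ_congr e (isDegTwoZ_add (isDegTwoZ_add ?_ ?_) (isDegTwoZ_ev P (ptv B c) (isAffZ_ptv B c)))
  · exact isDegTwoZ_sum _ (fun a x => bit (tOf x a) * bit (sOf x a)) fun a _ =>
      isDegTwoZ_mul (isAffZ_coord (Fin.natAdd m a)) (isAffZ_coord (Fin.castAdd m a))
  · exact isDegTwoZ_sum _ (fun a x => ∑ a', bit (ut B a a') * (bit (sOf x a) * bit (sOf x a'))) fun a _ =>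
      isDegTwoZ_sum _ (fun a' x => bit (ut B a a') * (bit (sOf x a) * bit (sOf x a'))) fun a' _ =>
        isDegTwoZ_mul_const _ (isDegTwoZ_mul (isAffZ_coord (Fin.castAdd m a)) (isAffZ_coord (Fin.castAdd m a')))

/-! ### 11.3 summing the label first, and the bound -/

/-- `(s,t) ↦ x` -/
def stEquiv (m : ℕ) : (Fin (m + m) → Bool) ≃ (Fin m → Bool) × (Fin m → Bool) where
  toFun x := (sOf x, tOf x)
  invFun st := Fin.append st.1 st.2
  left_inv x := Fin.append_castAdd_natAdd
  right_inv st := by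
    obtain ⟨s, t⟩ := st
    refine Prod.ext (funext fun a => ?_) (funext fun a => ?_)
    · exact Fin.append_left s t a
    · exact Fin.append_right s t a

/-- the parameter sum as `Σ_B Σ_{(s,t)} Σ_b` -/
theorem sum_QParam (F : (Fin m → Bool) → (Fin m → Bool) → (Fin m → Fin m → Bool) → Bool → ℝ) :
    ∑ w : QParam m, F w.1 w.2.1 w.2.2.1 w.2.2.2
      = ∑ B : Fin m → Fin m → Bool, ∑ x : Fin (m + m) → Bool, ∑ b : Bool, F (sOf x) (tOf x) B b := by
  have h1 : ∑ w : QParam m, F w.1 w.2.1 w.2.2.1 w.2.2.2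
      = ∑ st : (Fin m → Bool) × (Fin m → Bool), ∑ B : Fin m → Fin m → Bool, ∑ b : Bool, F st.1 st.2 B b := by
    simp only [Fintype.sum_prod_type]
  have h2 : ∑ x : Fin (m + m) → Bool, ∑ B : Fin m → Fin m → Bool, ∑ b : Bool, F (sOf x) (tOf x) B b
      = ∑ st : (Fin m → Bool) × (Fin m → Bool), ∑ B : Fin m → Fin m → Bool, ∑ b : Bool, F st.1 st.2 B b :=
    Fintype.sum_equiv (stEquiv m) _ _ fun x => rfl
  rw [h1, ← h2, Finset.sum_comm]

/-- ★ summing over the label `b` first: `Σ_b (−1)^b (−1)^{f(s,t,B,b)} = Σ_c (−1)^c (−1)^{G_{P,B,c}(s,t)}` -/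
theorem bsum_eq (P : QuadP (CVar m)) {f : QParam m → Bool} (hP : ∀ w, bit (f w) = P.ev (cval w))
    (B : Fin m → Fin m → Bool) (x : Fin (m + m) → Bool) :
    ∑ b : Bool, signOf b * signOf (f (sOf x, tOf x, B, b)) = ∑ c : Bool, signOf c * signOf (gph P B c x) := by
  have hf : ∀ b, f (sOf x, tOf x, B, b) = unbit (P.ev (ptv B (xor b (c0 B x)) x)) := fun b => by
    rw [← unbit_bit (f _), hP, cval_eq_ptv]
  have sT : signOf true = -1 := by simp [signOf]
  have sF : signOf false = 1 := by simp [signOf]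
  simp only [Fintype.sum_bool, hf, gph]
  cases c0 B x
  · simp only [Bool.xor_false, Bool.false_xor]
  · simp only [Bool.xor_true, Bool.true_xor, Bool.not_true, Bool.not_false, Literature.Computability.QuantumComplexity.DerivativeWalsh.signOf_not, sT, sF]
    ring

/-- ★★ THEOREM A (bound form): `|Σ_w (−1)^b(−1)^{f w}| ≤ Σ_B Σ_c √(2^{2m}·|rad2 G_{P,B,c}|)` -/
theorem abs_corr_le_radSum (P : QuadP (CVar m)) {f : QParam m → Bool} (hP : ∀ w, bit (f w) = P.ev (cval w)) :
    |∑ w : QParam m, signOf w.2.2.2 * signOf (f w)|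
      ≤ ∑ B : Fin m → Fin m → Bool, ∑ c : Bool, Real.sqrt ((2 : ℝ) ^ (m + m) * ((rad2 (gph P B c)).card : ℝ)) := by
  have e1 : ∑ w : QParam m, signOf w.2.2.2 * signOf (f w)
      = ∑ B : Fin m → Fin m → Bool, ∑ c : Bool, signOf c * ∑ x : Fin (m + m) → Bool, signOf (gph P B c x) := by
    rw [sum_QParam (fun s t B b => signOf b * signOf (f (s, t, B, b)))]
    refine sum_congr rfl fun B _ => ?_
    rw [sum_congr rfl fun x _ => bsum_eq P hP B x, Finset.sum_comm]
    exact sum_congr rfl fun c _ => (mul_sum _ _ _).symm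
  rw [e1]
  refine (abs_sum_le_sum_abs _ _).trans (sum_le_sum fun B _ => (abs_sum_le_sum_abs _ _).trans (sum_le_sum fun c _ => ?_))
  rw [abs_mul, abs_signOf, one_mul]
  exact Real.abs_le_sqrt (gauss_vdc _ (isDegTwo_gph P B c))

/-- ★★★ `RadBound` — THE MATRIX-LEMMA SHAPE: for every polynomial `p`, at some scale `m`, for every quadratic polynomial `P` in the
visible variables, `2·p(2m)·Σ_B Σ_c √(2^{2m}·|rad2 G_{P,B,c}|) < |QParam m| = 2^{2m+m²+1}`; with `|rad2 G| = 2^{2m − rank M_P(B)}`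
(rank–nullity) this reads `E_B 2^{−rank M_P(B)/2} < 1/(2p(2m))` — NODE-g16.md §4.8's MATRIX LEMMA gives `≤ 200·2^{−m/32}`. -/
def RadBound : Prop :=
  ∀ p : Polynomial ℕ, ∃ m : ℕ, ∀ P : QuadP (CVar m),
    2 * ((p.eval (m + m) : ℕ) : ℝ) * ∑ B : Fin m → Fin m → Bool, ∑ c : Bool,
        Real.sqrt ((2 : ℝ) ^ (m + m) * ((rad2 (gph P B c)).card : ℝ)) < Fintype.card (QParam m)

/-- ★★★ [kernel, THEOREM A] `RadBound → CoreBias` (hence `→ KeyBias → VoteRung2NU → VoteRung2`). -/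
theorem coreBias_of_radBound (h : RadBound) : CoreBias := by
  intro p
  obtain ⟨m, hm⟩ := h p
  refine ⟨m, fun f hf => ?_⟩
  obtain ⟨P, hP⟩ := hf
  have hp : (0 : ℝ) ≤ 2 * ((p.eval (m + m) : ℕ) : ℝ) := by positivity
  exact (mul_le_mul_of_nonneg_left (abs_corr_le_radSum P hP) hp).trans_lt (hm P)

/-- PerceptronDialLawsE helper `voteRung2_of_radBound` (decomp-qadv land package; see the module docstring). -/
theorem voteRung2_of_radBound (h : RadBound) : VoteRung2 := voteRung2_of_coreBias (coreBias_of_radBound h)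

end ThmA

/-! ## §12  Rank–nullity for the radical (F2c): `|rad2 Q|·2^{rank(polM Q)} = 2ⁿ`, and `RadBound` in RANK form

For `Q` of algebraic degree `≤ 2` the second difference `diff2 Q` is a symmetric BI-ADDITIVE form; transported to `𝔽₂ⁿ` (`toZ`/`ofZ`) it is an
honest bilinear form `polL Q` over `ZMod 2` whose Gram matrix is ★ `polM Q` — THE POLAR MATRIX, defined proof-free as `(polM Q)_{ij} = diff2 Q eᵢ eⱼ` (`polM_eq_toMatrix`).  `rad2 Q` is (in bijection with)
the kernel of `polM Q` (`mulVec_polM_eq_zero_iff`, `rad2EquivKer`), so rank–nullity over the field `𝔽₂` gives ★ `card_rad2_mul_two_pow_rank :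
|rad2 Q| · 2^{rank (polM Q)} = 2ⁿ`.  Consequently `√(2ⁿ·|rad2 Q|) = 2ⁿ·2^{−rank/2}` (`sqrt_rad2_eq`) and §11's `RadBound` is implied by (indeed equivalent to —
only the used direction is filed, the EQUIV budget is spent on `voteRung2NU_iff`) ★★★ `RankBound`: for every polynomial `p`, at some scale `m`, for every quadratic
`P` in the visible variables, `2·p(2m)·Σ_B Σ_c 2^{2m}·2^{−rank polM(G_{P,B,c})/2} < |QParam m|`, i.e. `E_B E_c 2^{−rank M_{P,B,c}/2} < 1/(2p(2m))` with
`M_{P,B,c} = polM (gph P B c)` the `2m × 2m` polar matrix over `𝔽₂` of the explicit phase — LITERALLY the expectation bounded by the MATRIX LEMMA of NODE-g16.md §4.8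
(whose block formula for `M_{P,B,c}` in terms of `Ũ = [a<a']B ⊕ [a<a']Bᵀ` and the coefficients of `P` is the one remaining dictionary step, validated numerically
by `aux/ufirst_check.py`).  ★ `coreBias_of_rankBound`, `voteRung2_of_rankBound`. -/

section RankCount

open scoped Matrix

variable {n : ℕ}

/-! ### 12.1 Boolean vectors as `𝔽₂`-vectors; the polar form is bilinear -/

/-- `{0,1}ⁿ → 𝔽₂ⁿ` -/
def toZ (x : Fin n → Bool) : Fin n → ZMod 2 := fun i => bit (x i)
/-- `𝔽₂ⁿ → {0,1}ⁿ` -/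
def ofZ (v : Fin n → ZMod 2) : Fin n → Bool := fun i => unbit (v i)

/-- PerceptronDialLawsE helper `ofZ_toZ` (decomp-qadv land package; see the module docstring). -/
theorem ofZ_toZ (x : Fin n → Bool) : ofZ (toZ x) = x := funext fun i => unbit_bit (x i)
/-- PerceptronDialLawsE helper `toZ_ofZ` (decomp-qadv land package; see the module docstring). -/
theorem toZ_ofZ (v : Fin n → ZMod 2) : toZ (ofZ v) = v := funext fun i => bit_unbit (v i)

/-- PerceptronDialLawsE helper `unbit_zero` (decomp-qadv land package; see the module docstring). -/
theorem unbit_zero : unbit (0 : ZMod 2) = false := by decide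

/-- PerceptronDialLawsE helper `ofZ_add` (decomp-qadv land package; see the module docstring). -/
theorem ofZ_add (v w : Fin n → ZMod 2) : ofZ (v + w) = bxor (ofZ v) (ofZ w) := by
  funext i
  apply bit_injective
  show bit (unbit (v i + w i)) = bit (xor (unbit (v i)) (unbit (w i)))
  rw [bit_xor, bit_unbit, bit_unbit, bit_unbit]

/-- PerceptronDialLawsE helper `ofZ_zero` (decomp-qadv land package; see the module docstring). -/
theorem ofZ_zero : ofZ (0 : Fin n → ZMod 2) = zeroVec := by
  funext i
  exact unbit_zero

/-- PerceptronDialLawsE helper `diff2_comm` (decomp-qadv land package; see the module docstring). -/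
theorem diff2_comm (Q : (Fin n → Bool) → Bool) (h x : Fin n → Bool) : diff2 Q h x = diff2 Q x h := by
  have e : bxor x h = bxor h x := funext fun i => Bool.xor_comm _ _
  simp only [diff2, e]
  generalize Q (bxor h x) = a; generalize Q x = b; generalize Q h = c; generalize Q zeroVec = d
  cases a <;> cases b <;> cases c <;> cases d <;> rfl

/-- PerceptronDialLawsE helper `diff2_zeroVec_left` (decomp-qadv land package; see the module docstring). -/
theorem diff2_zeroVec_left (Q : (Fin n → Bool) → Bool) (x : Fin n → Bool) : diff2 Q zeroVec x = false := by
  have e : bxor x zeroVec = x := funext fun i => Bool.xor_false _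
  simp only [diff2, e]
  generalize Q x = a; generalize Q zeroVec = d
  cases a <;> cases d <;> rfl

/-- the polar (second-difference) form of `Q`, transported to `𝔽₂ⁿ` -/
def dform (Q : (Fin n → Bool) → Bool) (v w : Fin n → ZMod 2) : ZMod 2 := bit (diff2 Q (ofZ v) (ofZ w))

/-- PerceptronDialLawsE helper `dform_comm` (decomp-qadv land package; see the module docstring). -/
theorem dform_comm (Q : (Fin n → Bool) → Bool) (v w : Fin n → ZMod 2) : dform Q v w = dform Q w v := by
  unfold dform; rw [diff2_comm]

/-- PerceptronDialLawsE helper `dform_add_right` (decomp-qadv land package; see the module docstring). -/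
theorem dform_add_right (Q : (Fin n → Bool) → Bool) (hQ : IsDegTwo Q) (v w₁ w₂ : Fin n → ZMod 2) :
    dform Q v (w₁ + w₂) = dform Q v w₁ + dform Q v w₂ := by
  unfold dform; rw [ofZ_add, hQ, bit_xor]

/-- PerceptronDialLawsE helper `dform_add_left` (decomp-qadv land package; see the module docstring). -/
theorem dform_add_left (Q : (Fin n → Bool) → Bool) (hQ : IsDegTwo Q) (v₁ v₂ w : Fin n → ZMod 2) :
    dform Q (v₁ + v₂) w = dform Q v₁ w + dform Q v₂ w := by
  rw [dform_comm, dform_add_right Q hQ, dform_comm Q w, dform_comm Q w]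

/-- PerceptronDialLawsE helper `dform_zero_left` (decomp-qadv land package; see the module docstring). -/
theorem dform_zero_left (Q : (Fin n → Bool) → Bool) (w : Fin n → ZMod 2) : dform Q 0 w = 0 := by
  unfold dform; rw [ofZ_zero, diff2_zeroVec_left, bit_false]

/-- PerceptronDialLawsE helper `dform_smul_left` (decomp-qadv land package; see the module docstring). -/
theorem dform_smul_left (Q : (Fin n → Bool) → Bool) (c : ZMod 2) (v w : Fin n → ZMod 2) :
    dform Q (c • v) w = c • dform Q v w := by
  rcases (show c = 0 ∨ c = 1 by revert c; decide) with rfl | rfl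
  · rw [zero_smul, zero_smul, dform_zero_left]
  · rw [one_smul, one_smul]

/-- PerceptronDialLawsE helper `dform_smul_right` (decomp-qadv land package; see the module docstring). -/
theorem dform_smul_right (Q : (Fin n → Bool) → Bool) (c : ZMod 2) (v w : Fin n → ZMod 2) :
    dform Q v (c • w) = c • dform Q v w := by
  rw [dform_comm, dform_smul_left, dform_comm]

/-- the polar form of a degree-`≤ 2` function as an `𝔽₂`-BILINEAR map -/
def polL (Q : (Fin n → Bool) → Bool) (hQ : IsDegTwo Q) :
    (Fin n → ZMod 2) →ₗ[ZMod 2] (Fin n → ZMod 2) →ₗ[ZMod 2] ZMod 2 :=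
  LinearMap.mk₂ (ZMod 2) (dform Q) (dform_add_left Q hQ) (dform_smul_left Q) (dform_add_right Q hQ) (dform_smul_right Q)

/-- PerceptronDialLawsE helper `polL_apply` (decomp-qadv land package; see the module docstring). -/
theorem polL_apply (Q : (Fin n → Bool) → Bool) (hQ : IsDegTwo Q) (v w : Fin n → ZMod 2) :
    polL Q hQ v w = dform Q v w := rfl

/-- ★ THE POLAR MATRIX of `Q` over `𝔽₂` (proof-free definition): `(polM Q)_{ij} = diff2 Q eᵢ eⱼ`. -/
def polM (Q : (Fin n → Bool) → Bool) : Matrix (Fin n) (Fin n) (ZMod 2) :=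
  Matrix.of fun i j => bit (diff2 Q (ofZ (Pi.single i 1)) (ofZ (Pi.single j 1)))

/-- PerceptronDialLawsE helper `polM_apply` (decomp-qadv land package; see the module docstring). -/
theorem polM_apply (Q : (Fin n → Bool) → Bool) (i j : Fin n) :
    polM Q i j = bit (diff2 Q (ofZ (Pi.single i 1)) (ofZ (Pi.single j 1))) := rfl

/-- for `deg Q ≤ 2` it is the Gram matrix of the bilinear form `polL` in the standard basis -/
theorem polM_eq_toMatrix (Q : (Fin n → Bool) → Bool) (hQ : IsDegTwo Q) :
    polM Q = LinearMap.toMatrix₂' (ZMod 2) (polL Q hQ) := by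
  ext i j
  rfl

/-- PerceptronDialLawsE helper `dotProduct_polM_mulVec` (decomp-qadv land package; see the module docstring). -/
theorem dotProduct_polM_mulVec (Q : (Fin n → Bool) → Bool) (hQ : IsDegTwo Q) (v w : Fin n → ZMod 2) :
    v ⬝ᵥ (polM Q *ᵥ w) = dform Q v w := by
  rw [polM_eq_toMatrix Q hQ, ← Matrix.toLinearMap₂'_apply', Matrix.toLinearMap₂'_toMatrix']
  rfl

/-- ★ the kernel of the polar matrix is the radical -/
theorem mulVec_polM_eq_zero_iff (Q : (Fin n → Bool) → Bool) (hQ : IsDegTwo Q) (w : Fin n → ZMod 2) :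
    polM Q *ᵥ w = 0 ↔ ofZ w ∈ rad2 Q := by
  constructor
  · intro h0
    simp only [rad2, mem_filter, mem_univ, true_and]
    intro x
    apply bit_injective
    have key := dotProduct_polM_mulVec Q hQ (toZ x) w
    rw [h0, dotProduct_zero] at key
    have e : dform Q (toZ x) w = bit (diff2 Q x (ofZ w)) := by
      unfold dform; rw [ofZ_toZ]
    rw [bit_false, diff2_comm, ← e, ← key]
  · intro hw
    simp only [rad2, mem_filter, mem_univ, true_and] at hw
    funext i
    rw [Pi.zero_apply, ← single_one_dotProduct i (polM Q *ᵥ w), dotProduct_polM_mulVec Q hQ]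
    unfold dform
    rw [diff2_comm, hw, bit_false]

/-- `rad2 Q ≃ ker (polM Q)` -/
noncomputable def rad2EquivKer (Q : (Fin n → Bool) → Bool) (hQ : IsDegTwo Q) :
    {h // h ∈ rad2 Q} ≃ LinearMap.ker (polM Q).mulVecLin where
  toFun h := ⟨toZ h.1, by
    rw [LinearMap.mem_ker, Matrix.mulVecLin_apply, mulVec_polM_eq_zero_iff Q hQ, ofZ_toZ]; exact h.2⟩
  invFun w := ⟨ofZ w.1, (mulVec_polM_eq_zero_iff Q hQ w.1).1 (by
    have hw := w.2
    rwa [LinearMap.mem_ker, Matrix.mulVecLin_apply] at hw)⟩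
  left_inv h := Subtype.ext (ofZ_toZ h.1)
  right_inv w := Subtype.ext (toZ_ofZ w.1)

/-- ★ LAW (rank–nullity over `𝔽₂`): `|rad2 Q| · 2^{rank (polM Q)} = 2ⁿ` for every `Q` of algebraic degree `≤ 2`. -/
theorem card_rad2_mul_two_pow_rank (Q : (Fin n → Bool) → Bool) (hQ : IsDegTwo Q) :
    (rad2 Q).card * 2 ^ (polM Q).rank = 2 ^ n := by
  have h1 : (rad2 Q).card = Nat.card (LinearMap.ker (polM Q).mulVecLin) := by
    rw [← Nat.card_congr (rad2EquivKer Q hQ), Nat.card_eq_fintype_card, Fintype.card_coe]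
  have h2 : Nat.card (LinearMap.ker (polM Q).mulVecLin)
      = 2 ^ Module.finrank (ZMod 2) (LinearMap.ker (polM Q).mulVecLin) := by
    rw [Module.natCard_eq_pow_finrank (K := ZMod 2), Nat.card_eq_fintype_card, ZMod.card]
  have h3 : (polM Q).rank + Module.finrank (ZMod 2) (LinearMap.ker (polM Q).mulVecLin) = n := by
    have h := LinearMap.finrank_range_add_finrank_ker (K := ZMod 2) (polM Q).mulVecLin
    rw [Module.finrank_fintype_fun_eq_card, Fintype.card_fin] at h
    exact h
  rw [h1, h2, ← pow_add, add_comm, h3]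

/-- `√(2ⁿ·|rad2 Q|) = 2ⁿ / 2^{rank/2}` -/
theorem sqrt_rad2_eq (Q : (Fin n → Bool) → Bool) (hQ : IsDegTwo Q) :
    Real.sqrt ((2 : ℝ) ^ n * ((rad2 Q).card : ℝ)) = (2 : ℝ) ^ n / Real.sqrt ((2 : ℝ) ^ (polM Q).rank) := by
  have hc : ((rad2 Q).card : ℝ) * (2 : ℝ) ^ (polM Q).rank = (2 : ℝ) ^ n := by
    exact_mod_cast card_rad2_mul_two_pow_rank Q hQ
  have hpos : (0 : ℝ) < Real.sqrt ((2 : ℝ) ^ (polM Q).rank) := Real.sqrt_pos.2 (by positivity)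
  rw [eq_div_iff hpos.ne', ← Real.sqrt_mul (by positivity)]
  rw [show (2 : ℝ) ^ n * ((rad2 Q).card : ℝ) * (2 : ℝ) ^ (polM Q).rank = ((2 : ℝ) ^ n) ^ 2 by
    rw [mul_assoc, hc, sq]]
  exact Real.sqrt_sq (by positivity)

/-! ### 12.2 `RadBound` in rank form -/

variable {m : ℕ}

/-- ★★★ `RankBound` — the MATRIX-LEMMA expectation itself: for every polynomial `p`, at some scale `m`, for every quadratic `P` in the visible variables,
`2·p(2m)·Σ_B Σ_{c∈𝔽₂} 2^{2m} / 2^{rank M_{P,B,c} / 2} < |QParam m| (= 2^{m²+2m+1})`, where `M_{P,B,c} = polM (gph P B c)` is the `2m × 2m` polar matrix over `𝔽₂` of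
the explicit degree-2 phase `G_{P,B,c}(s,t) = ⟨t,s⟩ ⊕ Q_B(s) ⊕ P(ptv_B^c(s,t))`; equivalently `E_{B,c} 2^{−rank M_{P,B,c}/2} < 1/(2·p(2m))`.
NODE-g16.md §4.8: `M_{P,B,c}` has the block form `[[ŨΞŨ ⊕ Ũ ⊕ ZŨ ⊕ ŨZᵀ ⊕ S₀, I ⊕ C₀ ⊕ ŨC₁],[…ᵀ, T₀]]` (`Ũ = [a<a']B ⊕ [a<a']Bᵀ` uniform alternating) and the
MATRIX LEMMA bounds the expectation by `200·2^{−m/32}`. -/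
def RankBound : Prop :=
  ∀ p : Polynomial ℕ, ∃ m : ℕ, ∀ P : QuadP (CVar m),
    2 * ((p.eval (m + m) : ℕ) : ℝ) * ∑ B : Fin m → Fin m → Bool, ∑ c : Bool,
        (2 : ℝ) ^ (m + m) / Real.sqrt ((2 : ℝ) ^ (polM (gph P B c)).rank) < Fintype.card (QParam m)

/-- ★★★ [kernel] `RankBound → RadBound` (the summands agree term by term by `sqrt_rad2_eq`; the converse holds by the same identity and is not filed). -/
theorem radBound_of_rankBound (h : RankBound) : RadBound := by
  intro p
  obtain ⟨m, hm⟩ := h p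
  refine ⟨m, fun P => ?_⟩
  have e : ∑ B : Fin m → Fin m → Bool, ∑ c : Bool, Real.sqrt ((2 : ℝ) ^ (m + m) * ((rad2 (gph P B c)).card : ℝ))
      = ∑ B : Fin m → Fin m → Bool, ∑ c : Bool,
          (2 : ℝ) ^ (m + m) / Real.sqrt ((2 : ℝ) ^ (polM (gph P B c)).rank) :=
    sum_congr rfl fun B _ => sum_congr rfl fun c _ => sqrt_rad2_eq _ (isDegTwo_gph P B c)
  rw [e]
  exact hm P

/-- ★★★ [kernel] `RankBound → CoreBias` — W₂'s open content as ONE statement about ranks of explicit `𝔽₂`-matrices. -/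
theorem coreBias_of_rankBound (h : RankBound) : CoreBias := coreBias_of_radBound (radBound_of_rankBound h)

/-- PerceptronDialLawsE helper `voteRung2_of_rankBound` (decomp-qadv land package; see the module docstring). -/
theorem voteRung2_of_rankBound (h : RankBound) : VoteRung2 := voteRung2_of_radBound (radBound_of_rankBound h)

end RankCount


end Summit.QuantumAdvantage.QuantumAdvantage.Theorems.PerceptronDial
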